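import Summits.Ventures.CertifiedQuantumChemistry.Rows.T2PrimeCongruence
import Literature.MathematicalPhysics.QuantumChemistry.RelaxationSymmetryAveraging
import HarnessLib

/-!
# Rows/SpinBlockingLossless.lean — the two-body `S_z` blocking of `Γ` is LOSSLESS for the printed sector programmes, and `T2′ ≡ T2` in value (rdm-A, `qchem-cert` gen 56)

"certified bounds for a stated model Hamiltonian in a stated basis; not a claim about the real
molecule beyond that model".

WHAT. The cell's instances (`FORMAT-qcl1.md`) carry only the `S_z`-charge-diagonal blocks of the
2-matrix, i.e. they ADD the two-body selection rule `Γ_{(i,j),(k,l)} = 0 unless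
s(i) + s(j) = s(k) + s(l)` (`s = 0, 1` for `α, β`) to the printed sector rows — Mazziotti (2007)
§II.F prints only the ONE-body rule and the sector traces (87)–(90). This file proves that the extra
rows cost nothing: for every spin-free integral table `(h, g, h_nuc)` and every `(N_α, N_β) = (a, b)`
* `forall_isDQGFeasibleSector_iff_forall_twoSpinSel`, `forall_isDQGFeasibleSector_t1_t2_iff_forall_twoSpinSel`
  — a real number bounds the energy below on ALL sector-feasible pairs iff it does so on the
  spin-BLOCKED ones (`DQG` / `DQGT1T2` rungs: the blocked instance bounds exactly `E_PQG(a, b)`);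
and, combined with `Rows/T2PrimeCongruence.lean` (`T2′ ⪰ 0 ⟺ T2 ⪰ 0` on spin-blocked sector pairs
with `a, b ≠ 0`),
* `forall_isDQGT1T2PrimeFeasibleSector_iff_forall_t1_t2`, `pqgT1T2pSectorEnergy_eq_sInf_t1_t2` —
  **`E_PQGT1T2′(a, b) = inf {E(γ, Γ) : sector-DQG, T1 ⪰ 0, T2 ⪰ 0}` for `a, b ≥ 1`**: on the
  sector rows the printed `T2′` strengthening of `T2` (Nakata et al. 2008 §II.B) changes no value.

HOW (one idea). The spin rotation `e^{iθŜ_z}` acts on `(γ, Γ)` by the diagonal-unitary PHASE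
CONGRUENCE `γ_ik ↦ v^{s(i)} v̄^{s(k)} γ_ik`, `Γ_pq ↦ v^{s(p₁)+s(p₂)} v̄^{s(q₁)+s(q₂)} Γ_pq` (`v = e^{iθ}`).
§1: the printed maps `Q, G, T1, T2` are COVARIANT under any phase congruence with `φ·ψ = 1` (rdm-B's
delta insertion `δ_ab = φ_b ψ_a δ_ab` + `ring`, as in `Rows/OrbitalSignBlockingLossless(T).lean`, the
real case `φ = ψ = ±1`); §2: `⪰ 0` is preserved (`D M Dᴴ`); §3: so is sector-`DQG` feasibility, and a
`γ` obeying the one-body rule is FIXED; §4: the truncation `Γ̄` of `Γ` to its charge-diagonal blocks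
is the `ℤ₄` Reynolds average `¼ Σ_{t<4} Γ^{(iᵗ)}` (`ℤ₂`, `v = −1`, would keep the `ΔM = ±2` coherences
`Γ^{ββ}_{αα}`; the fourth roots of unity kill them, `sum_spinPhase_four`) — hence sector-feasible
(`IsDQGFeasibleSector.sum_smul`), `T1`/`T2`-feasible (`t1Map_sum_smul`, `t2Map_sum_smul`), with the
same `γ` and the same energy (the functional reads charge-conserving entries only); §5 assembles.
RELATION TO rdm-B's ROTATION SET (not imported, no byte touched): for UNITARY phases §1–§3 are the
diagonal case `U = diag φ` of `qMap/gMap/t1Map/t2Map_conj_unitary`, `isDQGFeasibleSector_conj_unitary`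
(`Rows/OrbitalRotationCovariance(T).lean`, `Rows/OrbitalRotationInvariance.lean`), re-derived entrywise
in six-line `ring` proofs because §4 is entrywise, and the `DQG` rung of §5 is the `G = ℤ₄ ⊂ U(1)_{S_z}`
instance of `le_pqgSectorEnergy_iff_rotationInvariant` (`Rows/OrbitalRotationAveraging.lean`) with the
invariant pairs IDENTIFIED (= the spin-blocked ones) and no energy hypothesis; new here: that
identification, the `T1`/`T2` rung, and `T2′ ≡ T2` in value.

NO `def`; 0 sorry. References: [cite: Mazziotti2007RDMChapter, §II.A-B, §II.F] D. A. Mazziotti,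
Adv. Chem. Phys. 134 (2007) 21–59, eqs. (4)–(7), (14)–(15), (87)–(90); [cite: NakataEtAl2008, §II.A-C]
M. Nakata, B. J. Braams, K. Fujisawa, M. Fukuda, J. K. Percus, M. Yamashita, Z. Zhao, JCP 128 (2008) 164113.
-/

noncomputable section

namespace Summit.Ventures.CertifiedQuantumChemistry

open Matrix Finset Literature.MathematicalPhysics.QuantumLattice Literature.MathematicalPhysics.QuantumChemistry
open scoped ComplexOrder

/-! ### §1 Covariance of the printed maps under a phase congruence -/
section Phase

variable {ι : Type*} [LinearOrder ι] {φ ψ : ι → ℂ} {γ : Matrix ι ι ℂ} {Γ : Matrix (ι × ι) (ι × ι) ℂ}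

/-- **A delta absorbs a phase and its inverse**, `δ_ab = φ_b ψ_a δ_ab` (`φ_x ψ_x = 1`); the right-hand
delta is an identity-matrix entry so that rewriting terminates (cf. rdm-B's `ite_eq_sign_mul_one`). -/
theorem ite_eq_phase_mul_one (h : ∀ x, φ x * ψ x = 1) (a b : ι) :
    (if a = b then (1 : ℂ) else 0) = φ b * ψ a * (1 : Matrix ι ι ℂ) a b := by
  by_cases hab : a = b
  · subst hab
    rw [if_pos rfl, Matrix.one_apply_eq, mul_one, h]
  · rw [if_neg hab, Matrix.one_apply_ne hab, mul_zero]

/-- A delta is an identity-matrix entry (orientation used on the untransformed side). -/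
theorem ite_eq_one_apply (a b : ι) : (if a = b then (1 : ℂ) else 0) = (1 : Matrix ι ι ℂ) a b :=
  Matrix.one_apply.symm

/-- **The `Q`-map is covariant under a phase congruence** `γ_ik ↦ φ_i ψ_k γ_ik`,
`Γ_pq ↦ φ_{p₁} φ_{p₂} ψ_{q₁} ψ_{q₂} Γ_pq` (`φ_x ψ_x = 1`): the two-hole matrix picks up the
contragredient phases (Mazziotti 2007 eq. (14)). [cite: Mazziotti2007RDMChapter, §II.B eq. (14)] -/
theorem qMap_phase (h : ∀ x, φ x * ψ x = 1) :
    qMap (Matrix.of fun i k => φ i * ψ k * γ i k)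
        (Matrix.of fun p q => φ p.1 * φ p.2 * (ψ q.1 * ψ q.2) * Γ p q) =
      Matrix.of fun p q => ψ p.1 * ψ p.2 * (φ q.1 * φ q.2) * qMap γ Γ p q := by
  ext ⟨i, j⟩ ⟨k, l⟩
  rw [Matrix.of_apply, qMap_apply, qMap_apply]
  simp only [Matrix.of_apply]
  conv_lhs => simp only [ite_eq_phase_mul_one h]
  conv_rhs => simp only [ite_eq_one_apply]
  ring

/-- **The `G`-map is covariant under a phase congruence**: the particle-hole matrix picks up
`φ_{p₁} ψ_{p₂} ψ_{q₁} φ_{q₂}` (Mazziotti 2007 eq. (15)). [cite: Mazziotti2007RDMChapter, §II.B eq. (15)] -/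
theorem gMap_phase (h : ∀ x, φ x * ψ x = 1) :
    gMap (Matrix.of fun i k => φ i * ψ k * γ i k)
        (Matrix.of fun p q => φ p.1 * φ p.2 * (ψ q.1 * ψ q.2) * Γ p q) =
      Matrix.of fun p q => φ p.1 * ψ p.2 * (ψ q.1 * φ q.2) * gMap γ Γ p q := by
  ext ⟨i, j⟩ ⟨k, l⟩
  rw [Matrix.of_apply, gMap_apply, gMap_apply]
  simp only [Matrix.of_apply]
  by_cases hjl : j = l
  · rw [if_pos hjl, if_pos hjl, hjl]
    linear_combination (-(φ i * ψ k * γ i k)) * h l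
  · rw [if_neg hjl, if_neg hjl]
    ring

/-- **The `T1` functional is covariant under a phase congruence** (all 33 printed terms): insert
`φ ψ` under every delta of the transformed side, then `ring`. [cite: NakataEtAl2008, §II.A] -/
theorem t1Map_phase (h : ∀ x, φ x * ψ x = 1) :
    t1Map (Matrix.of fun i k => φ i * ψ k * γ i k)
        (Matrix.of fun p q => φ p.1 * φ p.2 * (ψ q.1 * ψ q.2) * Γ p q) =
      Matrix.of fun I J =>
        φ I.1 * φ I.2.1 * φ I.2.2 * (ψ J.1 * ψ J.2.1 * ψ J.2.2) * t1Map γ Γ I J := by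
  ext ⟨i, j, k⟩ ⟨l, m, n⟩
  rw [Matrix.of_apply, t1Map_apply, t1Map_apply]
  simp only [Matrix.of_apply]
  conv_lhs => simp only [ite_eq_phase_mul_one h]
  conv_rhs => simp only [ite_eq_one_apply]
  ring

/-- **The `T2` functional is covariant under a phase congruence**: the row `(i, j, k) ~ a†a†a`
picks up `φ_i φ_j ψ_k`, the column `ψ_l ψ_m φ_n`. [cite: NakataEtAl2008, §II.A] -/
theorem t2Map_phase (h : ∀ x, φ x * ψ x = 1) :
    t2Map (Matrix.of fun i k => φ i * ψ k * γ i k)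
        (Matrix.of fun p q => φ p.1 * φ p.2 * (ψ q.1 * ψ q.2) * Γ p q) =
      Matrix.of fun I J =>
        φ I.1 * φ I.2.1 * ψ I.2.2 * (ψ J.1 * ψ J.2.1 * φ J.2.2) * t2Map γ Γ I J := by
  ext ⟨i, j, k⟩ ⟨l, m, n⟩
  rw [Matrix.of_apply, t2Map_apply, t2Map_apply]
  simp only [Matrix.of_apply]
  conv_lhs => simp only [ite_eq_phase_mul_one h]
  conv_rhs => simp only [ite_eq_one_apply]
  ring

/-! ### §2 Diagonal unitary congruences preserve the printed cones -/
/-- `D M Dᴴ ⪰ 0` for `M ⪰ 0` and `D = diag c`, entrywise: `N_pq = c_p · conj(c_q) · M_pq`. [folklore] -/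
theorem posSemidef_of_forall_eq_phase_mul {α : Type*} [Fintype α] [DecidableEq α]
    {M N : Matrix α α ℂ} (hM : M.PosSemidef) (c : α → ℂ)
    (hN : ∀ p q, N p q = c p * star (c q) * M p q) : N.PosSemidef := by
  convert hM.mul_mul_conjTranspose_same (Matrix.diagonal c) using 1
  ext p q
  rw [Matrix.diagonal_conjTranspose, Matrix.mul_apply, hN]
  simp only [Matrix.diagonal_mul, Matrix.diagonal_apply, Pi.star_apply, mul_ite, mul_zero,
    Finset.sum_ite_eq', Finset.mem_univ, if_true]
  ring

/-- `T1 ⪰ 0` is preserved by a phase congruence with `ψ = conj φ` (a diagonal unitary). -/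
theorem t1Map_phase_posSemidef [Fintype ι] (h1 : ∀ x, φ x * ψ x = 1)
    (h2 : ∀ x, star (φ x) = ψ x) (hT : (t1Map γ Γ).PosSemidef) :
    (t1Map (Matrix.of fun i k => φ i * ψ k * γ i k)
      (Matrix.of fun p q => φ p.1 * φ p.2 * (ψ q.1 * ψ q.2) * Γ p q)).PosSemidef := by
  rw [t1Map_phase h1]
  exact posSemidef_of_forall_eq_phase_mul hT (fun I => φ I.1 * φ I.2.1 * φ I.2.2) fun I J => by
    simp only [Matrix.of_apply, star_mul', h2]

/-- `T2 ⪰ 0` is preserved by a phase congruence with `ψ = conj φ`. -/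
theorem t2Map_phase_posSemidef [Fintype ι] (h1 : ∀ x, φ x * ψ x = 1)
    (h2 : ∀ x, star (φ x) = ψ x) (hT : (t2Map γ Γ).PosSemidef) :
    (t2Map (Matrix.of fun i k => φ i * ψ k * γ i k)
      (Matrix.of fun p q => φ p.1 * φ p.2 * (ψ q.1 * ψ q.2) * Γ p q)).PosSemidef := by
  have h3 : ∀ x, star (ψ x) = φ x := fun x => by rw [← h2, star_star]
  rw [t2Map_phase h1]
  exact posSemidef_of_forall_eq_phase_mul hT (fun I => φ I.1 * φ I.2.1 * ψ I.2.2) fun I J => by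
    simp only [Matrix.of_apply, star_mul', h2, h3]

/-- The `ℤ₄ ⊂ U(1)_{S_z}` character sums that implement the two-body `S_z` projection: for spin
labels `a, b, c, d ∈ {0, 1}`, `Σ_{t<4} i^{ta} i^{tb} conj(i^t)^c conj(i^t)^d = 4·[a + b = c + d]`. -/
theorem sum_spinPhase_four {a b c d : ℕ} (ha : a ≤ 1) (hb : b ≤ 1) (hc : c ≤ 1) (hd : d ≤ 1) :
    ∑ t ∈ Finset.range 4, (Complex.I ^ t) ^ a * (Complex.I ^ t) ^ b *
        (star (Complex.I ^ t) ^ c * star (Complex.I ^ t) ^ d) = if a + b = c + d then 4 else 0 := by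
  have hI : star Complex.I = -Complex.I := Complex.conj_I
  simp only [Finset.sum_range_succ, Finset.sum_range_zero, star_pow, hI]
  interval_cases a <;> interval_cases b <;> interval_cases c <;> interval_cases d <;>
    norm_num [pow_succ, Complex.ext_iff]

end Phase

/-! ### §3 The `S_z`-sector programme under spin-phase congruences -/
section Sector

variable {Λ : Type*} [LinearOrder Λ] [Fintype Λ] {a b : ℕ} {γ : Matrix (Orb Λ) (Orb Λ) ℂ}
  {Γ : Matrix (Orb Λ × Orb Λ) (Orb Λ × Orb Λ) ℂ}

/-- **Sector DQG feasibility is invariant under a phase congruence with `ψ = conj φ`** (ANY diagonal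
unitary of the spin-orbital space): `D, Q, G` transform by diagonal unitaries; Hermiticity, antisymmetry
and every printed row are unchanged. [cite: Mazziotti2007RDMChapter, §II.F eqs. (87)-(90)] -/
theorem isDQGFeasibleSector_phase {φ ψ : Orb Λ → ℂ} (h1 : ∀ x, φ x * ψ x = 1)
    (h2 : ∀ x, star (φ x) = ψ x) (h : IsDQGFeasibleSector a b γ Γ) :
    IsDQGFeasibleSector a b (Matrix.of fun i k => φ i * ψ k * γ i k)
      (Matrix.of fun p q => φ p.1 * φ p.2 * (ψ q.1 * ψ q.2) * Γ p q) := by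
  have h3 : ∀ x, star (ψ x) = φ x := fun x => by rw [← h2, star_star]
  have h4 : ∀ i j : Orb Λ, φ i * φ j * (ψ i * ψ j) = 1 := fun i j => by
    linear_combination (φ j * ψ j) * h1 i + h1 j
  refine
    { dqg := ?_, trace_upUp := ?_, trace_downDown := ?_, trace_upDown := ?_,
      spin_sel := fun p q σ τ hστ => by simp only [Matrix.of_apply, h.spin_sel p q σ τ hστ, mul_zero],
      trace_up := by simp only [Matrix.of_apply, h1, one_mul]; exact h.trace_up,
      trace_down := by simp only [Matrix.of_apply, h1, one_mul]; exact h.trace_down }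
  · refine
      { herm_one := ?_, q_psd := ?_, g_psd := ?_, contract := ?_,
        d_psd := posSemidef_of_forall_eq_phase_mul h.dqg.d_psd (fun p => φ p.1 * φ p.2) fun p q => by
          simp only [Matrix.of_apply, star_mul', h2],
        trace_one := by simp only [Matrix.of_apply, h1, one_mul]; exact h.dqg.trace_one,
        swap_fst := fun i j q => by simp only [Matrix.of_apply, h.dqg.swap_fst i j q]; ring,
        swap_snd := fun p k l => by simp only [Matrix.of_apply, h.dqg.swap_snd p k l]; ring }
    · refine Matrix.IsHermitian.ext fun i k => ?_
      simp only [Matrix.of_apply, star_mul', h2, h3]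
      rw [← h.dqg.herm_one.apply i k]
      ring
    · rw [qMap_phase h1]
      exact posSemidef_of_forall_eq_phase_mul h.dqg.q_psd (fun p => ψ p.1 * ψ p.2) fun p q => by
        simp only [Matrix.of_apply, star_mul', h3]
    · rw [gMap_phase h1]
      exact posSemidef_of_forall_eq_phase_mul h.dqg.g_psd (fun p => φ p.1 * ψ p.2) fun p q => by
        simp only [Matrix.of_apply, star_mul', h2, h3]
    · intro i k
      have e : ∀ j, φ i * φ j * (ψ k * ψ j) * Γ (i, j) (k, j) = φ i * ψ k * Γ (i, j) (k, j) :=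
        fun j => by linear_combination (φ i * ψ k * Γ (i, j) (k, j)) * h1 j
      simp only [Matrix.of_apply, e]
      rw [← Finset.mul_sum, h.dqg.contract i k]
      ring
  · simp only [Matrix.of_apply, h4, one_mul]; exact h.trace_upUp
  · simp only [Matrix.of_apply, h4, one_mul]; exact h.trace_downDown
  · simp only [Matrix.of_apply, h4, one_mul]; exact h.trace_upDown

omit [LinearOrder Λ] [Fintype Λ] in
/-- Unimodular SPIN phases `φ_x = v^{s(x)}`, `ψ_x = v̄^{s(x)}` (`v v̄ = 1`): `φ_x ψ_x = 1`. -/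
theorem spinPhase_mul_star {v : ℂ} (hv : v * star v = 1) (x : Orb Λ) :
    v ^ (ofLex x).2.val * star v ^ (ofLex x).2.val = 1 := by rw [← mul_pow, hv, one_pow]

/-- A spin-phase congruence (the rotation `e^{iθŜ_z}` at `v = e^{iθ}`) FIXES every 1-matrix obeying
the `S_z` selection rule. [cite: Mazziotti2007RDMChapter, §II.F] -/
theorem spinPhase_one_eq {v : ℂ} (hv : v * star v = 1) (h : IsDQGFeasibleSector a b γ Γ) :
    (Matrix.of fun i k : Orb Λ => v ^ (ofLex i).2.val * star v ^ (ofLex k).2.val * γ i k) = γ := by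
  ext i k
  rw [Matrix.of_apply]
  by_cases hσ : (ofLex i).2 = (ofLex k).2
  · rw [hσ, spinPhase_mul_star hv, one_mul]
  · have h0 := h.spin_sel (ofLex i).1 (ofLex k).1 (ofLex i).2 (ofLex k).2 hσ
    simp only [orb, Prod.mk.eta, toLex_ofLex] at h0
    rw [h0, mul_zero]

/-- Hence **the spin-phase congruence of `Γ` ALONE**, `Γ_pq ↦ v^{s(p₁)+s(p₂)} v̄^{s(q₁)+s(q₂)} Γ_pq`,
permutes the sector-DQG-feasible pairs with a given `γ`. [cite: Mazziotti2007RDMChapter, §II.F] -/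
theorem isDQGFeasibleSector_spinPhase {v : ℂ} (hv : v * star v = 1) (h : IsDQGFeasibleSector a b γ Γ) :
    IsDQGFeasibleSector a b γ (Matrix.of fun p q : Orb Λ × Orb Λ =>
      v ^ (ofLex p.1).2.val * v ^ (ofLex p.2).2.val *
        (star v ^ (ofLex q.1).2.val * star v ^ (ofLex q.2).2.val) * Γ p q) := by
  have h' := isDQGFeasibleSector_phase (spinPhase_mul_star hv) (fun x => star_pow _ _) h
  rwa [spinPhase_one_eq hv h] at h'

/-! ### §4 The `ℤ₄` average = truncation to the two-body `S_z`-charge blocks -/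
omit [LinearOrder Λ] [Fintype Λ] in
/-- **The truncation `Γ̄_pq = [s(p₁)+s(p₂) = s(q₁)+s(q₂)] Γ_pq` of `Γ` to its two-body `S_z`-charge
blocks is the `ℤ₄` AVERAGE of the spin-phase congruences `v = iᵗ`** (`ℤ₂` keeps `ΔM = ±2` terms). -/
theorem twoSpinTrunc_eq_sum_spinPhase (Γ : Matrix (Orb Λ × Orb Λ) (Orb Λ × Orb Λ) ℂ) :
    (Matrix.of fun p q : Orb Λ × Orb Λ =>
        if (ofLex p.1).2.val + (ofLex p.2).2.val = (ofLex q.1).2.val + (ofLex q.2).2.val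
        then Γ p q else 0) =
      ∑ t ∈ Finset.range 4, (((1 / 4 : ℝ) : ℂ)) • Matrix.of fun p q : Orb Λ × Orb Λ =>
        (Complex.I ^ t) ^ (ofLex p.1).2.val * (Complex.I ^ t) ^ (ofLex p.2).2.val *
          (star (Complex.I ^ t) ^ (ofLex q.1).2.val * star (Complex.I ^ t) ^ (ofLex q.2).2.val) * Γ p q := by
  ext p q
  rw [Matrix.sum_apply, Matrix.of_apply]
  simp only [Matrix.smul_apply, Matrix.of_apply]
  rw [← Finset.smul_sum, ← Finset.sum_mul, sum_spinPhase_four (Nat.le_of_lt_succ (ofLex p.1).2.isLt)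
    (Nat.le_of_lt_succ (ofLex p.2).2.isLt) (Nat.le_of_lt_succ (ofLex q.1).2.isLt)
    (Nat.le_of_lt_succ (ofLex q.2).2.isLt)]
  split_ifs
  · rw [smul_eq_mul]
    push_cast
    ring
  · simp

/-- The `ℤ₄` phases are unimodular: `iᵗ · conj(iᵗ) = 1`. -/
theorem I_pow_mul_star_I_pow (t : ℕ) : Complex.I ^ t * star (Complex.I ^ t) = 1 := by
  have hI : star Complex.I = -Complex.I := Complex.conj_I
  rw [star_pow, ← mul_pow, hI, mul_neg, Complex.I_mul_I, neg_neg, one_pow]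

/-- The averaging weights: `Σ_{t<4} ¼ = 1` (as complex numbers). -/
theorem sum_range_four_quarter : ∑ _t ∈ Finset.range 4, (((1 / 4 : ℝ) : ℂ)) = 1 := by
  norm_num [Finset.sum_const, Finset.card_range]

/-- `Σ_{t<4} ¼ • x = x`. -/
theorem sum_range_four_quarter_smul {M : Type*} [AddCommGroup M] [Module ℂ M] (x : M) :
    ∑ _t ∈ Finset.range 4, (((1 / 4 : ℝ) : ℂ)) • x = x := by
  rw [← Finset.sum_smul, sum_range_four_quarter, one_smul]

/-- **The truncated pair `(γ, Γ̄)` is sector-DQG-feasible** whenever `(γ, Γ)` is: a Reynolds average of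
four congruent feasible points (`IsDQGFeasibleSector.sum_smul`). [cite: Mazziotti2007RDMChapter, §II.F] -/
theorem isDQGFeasibleSector_twoSpinTrunc (hf : IsDQGFeasibleSector a b γ Γ) :
    IsDQGFeasibleSector a b γ (Matrix.of fun p q : Orb Λ × Orb Λ =>
      if (ofLex p.1).2.val + (ofLex p.2).2.val = (ofLex q.1).2.val + (ofLex q.2).2.val
      then Γ p q else 0) := by
  have h' := IsDQGFeasibleSector.sum_smul (Finset.range 4) (fun _ => (1 / 4 : ℝ))
    (fun _ _ => by norm_num) (by norm_num [Finset.sum_const, Finset.card_range]) (γ := fun _ => γ)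
    fun t _ => isDQGFeasibleSector_spinPhase (I_pow_mul_star_I_pow t) hf
  rw [sum_range_four_quarter_smul] at h'
  rwa [twoSpinTrunc_eq_sum_spinPhase]

/-- **`T1 ⪰ 0` passes to the truncated pair** (§2, `spinPhase_one_eq`, `t1Map_sum_smul`).
[cite: NakataEtAl2008, §II.A] -/
theorem t1Map_twoSpinTrunc_posSemidef (hf : IsDQGFeasibleSector a b γ Γ) (hT : (t1Map γ Γ).PosSemidef) :
    (t1Map γ (Matrix.of fun p q : Orb Λ × Orb Λ =>
      if (ofLex p.1).2.val + (ofLex p.2).2.val = (ofLex q.1).2.val + (ofLex q.2).2.val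
      then Γ p q else 0)).PosSemidef := by
  rw [twoSpinTrunc_eq_sum_spinPhase]
  conv => enter [1, 1]; rw [← sum_range_four_quarter_smul γ]
  rw [t1Map_sum_smul _ _ sum_range_four_quarter]
  refine posSemidef_sum _ fun t _ => Matrix.PosSemidef.smul ?_ (Complex.zero_le_real.mpr (by norm_num))
  have h' := t1Map_phase_posSemidef (spinPhase_mul_star (I_pow_mul_star_I_pow t))
    (fun x => star_pow _ _) hT
  rwa [spinPhase_one_eq (I_pow_mul_star_I_pow t) hf] at h'

/-- **`T2 ⪰ 0` passes to the truncated pair** (`t2Map_sum_smul`). [cite: NakataEtAl2008, §II.A] -/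
theorem t2Map_twoSpinTrunc_posSemidef (hf : IsDQGFeasibleSector a b γ Γ) (hT : (t2Map γ Γ).PosSemidef) :
    (t2Map γ (Matrix.of fun p q : Orb Λ × Orb Λ =>
      if (ofLex p.1).2.val + (ofLex p.2).2.val = (ofLex q.1).2.val + (ofLex q.2).2.val
      then Γ p q else 0)).PosSemidef := by
  rw [twoSpinTrunc_eq_sum_spinPhase]
  conv => enter [1, 1]; rw [← sum_range_four_quarter_smul γ]
  rw [t2Map_sum_smul]
  refine posSemidef_sum _ fun t _ => Matrix.PosSemidef.smul ?_ (Complex.zero_le_real.mpr (by norm_num))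
  have h' := t2Map_phase_posSemidef (spinPhase_mul_star (I_pow_mul_star_I_pow t))
    (fun x => star_pow _ _) hT
  rwa [spinPhase_one_eq (I_pow_mul_star_I_pow t) hf] at h'

omit [LinearOrder Λ] in
/-- **The truncated pair has the same energy**: the spin-free functional reads charge-conserving
entries only (Mazziotti 2007 eqs. (4)–(7)). [cite: Mazziotti2007RDMChapter, §II.A-B] -/
theorem rdmEnergy_twoSpinTrunc (h : Λ → Λ → ℂ) (g : Λ → Λ → Λ → Λ → ℂ) (hnuc : ℂ)
    (γ : Matrix (Orb Λ) (Orb Λ) ℂ) (Γ : Matrix (Orb Λ × Orb Λ) (Orb Λ × Orb Λ) ℂ) :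
    rdmEnergy h g hnuc γ (Matrix.of fun p q : Orb Λ × Orb Λ =>
      if (ofLex p.1).2.val + (ofLex p.2).2.val = (ofLex q.1).2.val + (ofLex q.2).2.val
      then Γ p q else 0) = rdmEnergy h g hnuc γ Γ := by
  unfold rdmEnergy
  simp only [Matrix.of_apply, orb, ofLex_toLex, if_true]

/-! ### §5 Losslessness of the `S_z` blocking, and `T2′ ≡ T2` in value -/
/-- **LOSSLESS `S_z` blocking, `DQG` rung**: a real number lies below the energy on ALL sector-DQG-
feasible pairs iff it does so on those obeying the two-body `S_z` selection rule — the spin-blocked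
`DQG` instance bounds exactly the printed `E_PQG(N_α, N_β)`. [cite: Mazziotti2007RDMChapter, §II.F] -/
theorem forall_isDQGFeasibleSector_iff_forall_twoSpinSel (h : Λ → Λ → ℂ)
    (g : Λ → Λ → Λ → Λ → ℂ) (hnuc : ℂ) (a b : ℕ) (c : ℝ) :
    (∀ γ Γ, IsDQGFeasibleSector a b γ Γ → c ≤ (rdmEnergy h g hnuc γ Γ).re) ↔
      ∀ γ Γ, IsDQGFeasibleSector a b γ Γ →
        (∀ i j k l : Orb Λ, (ofLex i).2.val + (ofLex j).2.val ≠ (ofLex k).2.val + (ofLex l).2.val →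
          Γ (i, j) (k, l) = 0) →
        c ≤ (rdmEnergy h g hnuc γ Γ).re := by
  refine ⟨fun hc γ Γ hf _ => hc γ Γ hf, fun hc γ Γ hf => ?_⟩
  rw [← rdmEnergy_twoSpinTrunc h g hnuc γ Γ]
  exact hc γ _ (isDQGFeasibleSector_twoSpinTrunc hf) fun i j k l hne => by
    rw [Matrix.of_apply, if_neg hne]

/-- **LOSSLESS `S_z` blocking, `DQGT1T2` rung** (bound form). [cite: NakataEtAl2008, §II.A-C] -/
theorem forall_isDQGFeasibleSector_t1_t2_iff_forall_twoSpinSel (h : Λ → Λ → ℂ)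
    (g : Λ → Λ → Λ → Λ → ℂ) (hnuc : ℂ) (a b : ℕ) (c : ℝ) :
    (∀ γ Γ, IsDQGFeasibleSector a b γ Γ → (t1Map γ Γ).PosSemidef → (t2Map γ Γ).PosSemidef →
        c ≤ (rdmEnergy h g hnuc γ Γ).re) ↔
      ∀ γ Γ, IsDQGFeasibleSector a b γ Γ → (t1Map γ Γ).PosSemidef → (t2Map γ Γ).PosSemidef →
        (∀ i j k l : Orb Λ, (ofLex i).2.val + (ofLex j).2.val ≠ (ofLex k).2.val + (ofLex l).2.val →
          Γ (i, j) (k, l) = 0) →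
        c ≤ (rdmEnergy h g hnuc γ Γ).re := by
  refine ⟨fun hc γ Γ hf h1 h2 _ => hc γ Γ hf h1 h2, fun hc γ Γ hf h1 h2 => ?_⟩
  rw [← rdmEnergy_twoSpinTrunc h g hnuc γ Γ]
  exact hc γ _ (isDQGFeasibleSector_twoSpinTrunc hf) (t1Map_twoSpinTrunc_posSemidef hf h1)
    (t2Map_twoSpinTrunc_posSemidef hf h2) fun i j k l hne => by rw [Matrix.of_apply, if_neg hne]

/-- **`T2′ ≡ T2` in VALUE on the `S_z`-sector rows with `N_α, N_β ≥ 1`**: for every spin-free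
integral table, a real number lies below the energy on the printed sector `PQGT1T2′` feasible set iff
it does so on the printed sector `PQGT1T2` feasible set — the two sets agree up to the `S_z` blocking
of `Γ` (`Rows/T2PrimeCongruence.lean`), which is lossless (§4). [cite: NakataEtAl2008, §II.B-C] -/
theorem forall_isDQGT1T2PrimeFeasibleSector_iff_forall_t1_t2 {a b : ℕ} (ha : a ≠ 0) (hb : b ≠ 0)
    (h : Λ → Λ → ℂ) (g : Λ → Λ → Λ → Λ → ℂ) (hnuc : ℂ) (c : ℝ) :
    (∀ γ Γ, IsDQGT1T2PrimeFeasibleSector a b γ Γ → c ≤ (rdmEnergy h g hnuc γ Γ).re) ↔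
      ∀ γ Γ, IsDQGFeasibleSector a b γ Γ → (t1Map γ Γ).PosSemidef → (t2Map γ Γ).PosSemidef →
        c ≤ (rdmEnergy h g hnuc γ Γ).re :=
  (forall_isDQGT1T2PrimeFeasibleSector_iff ha hb).trans
    (forall_isDQGFeasibleSector_t1_t2_iff_forall_twoSpinSel h g hnuc a b c).symm

/-- **`E_PQGT1T2′(N_α, N_β) = inf {E(γ, Γ) : sector-DQG, T1 ⪰ 0, T2 ⪰ 0}` for `N_α, N_β ≥ 1`**
(value form). [cite: NakataEtAl2008, §II.B-C] -/
theorem pqgT1T2pSectorEnergy_eq_sInf_t1_t2 {a b : ℕ} (ha : a ≠ 0) (hb : b ≠ 0) (h : Λ → Λ → ℂ)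
    (g : Λ → Λ → Λ → Λ → ℂ) (hnuc : ℂ) :
    pqgT1T2pSectorEnergy h g hnuc a b =
      sInf {E : ℝ | ∃ γ Γ, IsDQGFeasibleSector a b γ Γ ∧ (t1Map γ Γ).PosSemidef ∧
        (t2Map γ Γ).PosSemidef ∧ E = (rdmEnergy h g hnuc γ Γ).re} := by
  unfold pqgT1T2pSectorEnergy
  congr 1
  ext E
  constructor
  · rintro ⟨γ, Γ, hf, hE⟩
    exact ⟨γ, Γ, hf.toIsDQGFeasibleSector, hf.t1_psd, hf.isDQGT1T2PrimeFeasible.t2Map_posSemidef, hE⟩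
  · rintro ⟨γ, Γ, hf, h1, h2, hE⟩
    exact ⟨γ, _, (isDQGT1T2PrimeFeasibleSector_iff ha hb).mpr ⟨isDQGFeasibleSector_twoSpinTrunc hf,
      t1Map_twoSpinTrunc_posSemidef hf h1, t2Map_twoSpinTrunc_posSemidef hf h2,
      fun i j k l hne => by rw [Matrix.of_apply, if_neg hne]⟩, by rw [rdmEnergy_twoSpinTrunc, hE]⟩

end Sector

end Summit.Ventures.CertifiedQuantumChemistry

end
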